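/-
COR-CM (cell pub-hodgecm2, stage 2 of the Hodge ladder) — count-neutral KERNEL COMBINATORICS «order 16: the quaternion doublings `Q₈ × ℤ/2` and
`Q₈ ∘ ℤ/4` (Pauli)», part VIII: THE LAW `μ(G, c) = φ₂(G, c)` for both doublings (seat prover-pub-hodgecm2-b23-g54-0, binder prover b23, gen 54;
claim HOME/INBOX.md l.25095).  Bookkeeping definition with body (the sign characters `sgnHom` of `Q₈ × ℤ/2`) + theorems on parts I–VII, lit-andre-3ʼs
`TypeStabiliser.fibreTwo_add_two_eq_card_block_add_indexTwoRank` and seat b09ʼs floor BY NAME; no `decide` beyond closed identities in `ZMod 2`/`Fin 8`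
and the two table lengths, no certificate, no named fact, no `sorry`.  `Interfaces.lean` (C1), every E term, B01, `Transposition/*`, `PortJoin/*`,
`D2Bridge/*` untouched.
HONEST FRAMING: `HC_CM` is NOT proved, here or anywhere in the tree; nothing here is a period, a count of record or a headline.
T5: n/a-class (hypothesis binders = the fields of `QuaternionDoubling.Datum`; inhabited in part «Instance»); checker: self.
-/
import Summits.HodgeConjecture.CorCM.Census.QuaternionDoublingChecklist
import Summits.HodgeConjecture.CorCM.Census.QuaternionDoublingTablesDirect
import Summits.HodgeConjecture.CorCM.Census.QuaternionDoublingTablesTwisted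
import Summits.HodgeConjecture.CorCM.Census.OcticProductStabiliser

/-!
# The quaternion doublings, VIII: THE LAW — `μ(Q₈ × ℤ/2, (−1, 0)) = φ₂ = 18 = β` and `μ(Pauli, z²) = φ₂ = 20 = β − 2`

* §1 **The count** (`isLeast_of_plan`): a valid plan with `|fam| + 2 ≤ |reps| + d₂(G/𝒦)` proves the census law `μ(G, c) = φ₂(G, c)` for every datum of
  its twist — generation by part VII, `|reps| ≤ β` by part VI, `φ₂ + 2 = β + d₂(G/𝒦)` (lit-andre-3), and seat b09ʼs floor `μ ≥ φ₂`.
* §2 **The sign characters of `Q₈ × ℤ/2`** (`τ = 0`): the exponents of `i` and of `j` in a word are homomorphisms `G → ℤ/2`; their kernels and the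
  kernel of their sum are three index-two subgroups containing `𝒦(G, c) = ⟨c, x⟩` (every word off `{1, x}·⟨c⟩` squares to `c`), so `d₂(G/𝒦) ≥ 2`.
* §3 **THE LAWS**: `Datum.isLeast_card_gfaces_generate_fibreTwo (D : Datum G c τ)` for both twists (plans of parts Va/Vb: `18 + 2 ≤ 18 + 2`,
  `20 + 2 ≤ 22 + 0`), with the ROWS `φ₂ = 18, β = 18, d₂ = 2` (`τ = 0`) and `φ₂ = 20, β = 22, d₂ = 0` (`τ = 1`) read off the same inequalities.
All [folklore] bookkeeping over [Pohlmann1968, Thm 1]; the dictionary blocks ↔ isogeny classes is [Milne1999, Prop. 2.1, p. 54] as in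
`Census/BlockParityLaw.lean` (cited, not formalised).

## References
* [Pohlmann1968] H. Pohlmann, Algebraic cycles on abelian varieties of complex multiplication type, Ann. of Math. 88 (1968), Thm 1.
* [Milne1999] J. S. Milne, Lefschetz motives and the Tate conjecture, Compositio Math. 117 (1999), Prop. 2.1, p. 54.
-/

namespace Summit.HodgeConjecture.CorCM.Census.QuaternionDoubling

open Finset
open Summit.HodgeConjecture.CorCM.Prior.AllgGroup.RfwfAllgGroup
open Summit.HodgeConjecture.CorCM.Census.BlockParity
open Summit.HodgeConjecture.CorCM.Census.Coinvariant
open Summit.HodgeConjecture.CorCM.Census.TypeStabiliser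
open Summit.HodgeConjecture.CorCM.Census.IndexTwo

noncomputable section

variable {G : Type*} [Group G] [Fintype G] [DecidableEq G] {c : G} {τ : ZMod 2}

/-! ## §1 The count -/

/-- **THE COUNT**: a valid plan with `|fam| + 2 ≤ |reps| + d₂(G/𝒦)` proves `μ(G, c) = φ₂(G, c)` for every datum of its twist, together with
`|fam| = φ₂`, `|reps| = β`. [folklore] -/
theorem isLeast_of_plan (D : Datum G c τ) (P : Plan) (hV : P.Valid τ = true)
    (hcount : P.fam.length + 2 ≤ P.reps.length + indexTwoRank (stabGen c)) :
    IsLeast {m : ℕ | ∃ S : Finset (CMF G c →₀ ℤ), ↑S ⊆ gfaceSet G c D.c_mul_c ∧ S.card = m ∧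
      hodgeSpan c D.c_mul_c ≤ Submodule.span ℤ (pairSet c) ⊔ Submodule.span ℤ (translates c S)} (fibreTwo c D.c_mul_c) ∧
    fibreTwo c D.c_mul_c = P.fam.length ∧ Fintype.card (Block c) = P.reps.length ∧
    indexTwoRank (stabGen c) + P.reps.length = P.fam.length + 2 := by
  classical
  obtain ⟨⟨S, hSF, hcard, hgen⟩, hreps⟩ := exists_generating_family D P hV
  have hfloor := OcticProduct.fibreTwo_mem_lowerBounds D.c_mul_c (Subgroup.mem_center_iff.mp D.c_mem_center)
  have hge : fibreTwo c D.c_mul_c ≤ S.card := hfloor ⟨S, hSF, rfl, hgen⟩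
  have heven : Even (Fintype.card G / 2) := by rw [D.card_eq]; decide
  have hphi := fibreTwo_add_two_eq_card_block_add_indexTwoRank c D.c_mul_c D.c_ne_one (Subgroup.mem_center_iff.mp D.c_mem_center) heven
  have hS : S.card = fibreTwo c D.c_mul_c := by omega
  exact ⟨⟨⟨S, hSF, hS, hgen⟩, hfloor⟩, by omega, by omega, by omega⟩

/-! ## §2 The sign characters of `Q₈ × ℤ/2` -/

section Characters

variable (D : Datum G c τ)

/-- The read-out of a mask `β` (a function of the place) on the word of an element. [folklore] -/
def sgnFun (β : Fin 8 → ZMod 2) (g : G) : ZMod 2 := β ((wordEquiv D).symm g).2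

omit [DecidableEq G] in
/-- `sgnFun` on a word. [folklore] -/
theorem sgnFun_word (β : Fin 8 → ZMod 2) (e : ZMod 2) (v : Fin 8) : sgnFun D β (word D e v) = β v := by
  simp [sgnFun]

/-- The exponent of `i`. [folklore] -/
def maskA : Fin 8 → ZMod 2 := ![0, 1, 0, 1, 0, 1, 0, 1]
/-- The exponent of `j`. [folklore] -/
def maskB : Fin 8 → ZMod 2 := ![0, 0, 1, 1, 0, 0, 1, 1]

/-- `maskA` is additive (along `i`, `j`; invariant along `x`; normalised). [folklore] -/
theorem addMask_A : (∀ v, maskA (πI v) = maskA v + maskA 1) ∧ (∀ v, maskA (πJ v) = maskA v + maskA 2) ∧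
    (∀ v, maskA (πX v) = maskA v) ∧ maskA 0 = 0 := ⟨by decide, by decide, by decide, by decide⟩
/-- `maskB` is additive. [folklore] -/
theorem addMask_B : (∀ v, maskB (πI v) = maskB v + maskB 1) ∧ (∀ v, maskB (πJ v) = maskB v + maskB 2) ∧
    (∀ v, maskB (πX v) = maskB v) ∧ maskB 0 = 0 := ⟨by decide, by decide, by decide, by decide⟩
/-- `maskA + maskB` is additive. [folklore] -/
theorem addMask_AB : (∀ v, (maskA + maskB) (πI v) = (maskA + maskB) v + (maskA + maskB) 1) ∧
    (∀ v, (maskA + maskB) (πJ v) = (maskA + maskB) v + (maskA + maskB) 2) ∧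
    (∀ v, (maskA + maskB) (πX v) = (maskA + maskB) v) ∧ (maskA + maskB) 0 = 0 := ⟨by decide, by decide, by decide, by decide⟩

variable {β : Fin 8 → ZMod 2}
  (hβ : (∀ v, β (πI v) = β v + β 1) ∧ (∀ v, β (πJ v) = β v + β 2) ∧ (∀ v, β (πX v) = β v) ∧ β 0 = 0)
include hβ

omit [DecidableEq G] in
/-- Right multiplication by `i`, `j`, `x`, `c` read through an additive mask. [folklore] -/
theorem sgnFun_mul_gen (g : G) :
    sgnFun D β (g * D.i) = sgnFun D β g + β 1 ∧ sgnFun D β (g * D.j) = sgnFun D β g + β 2 ∧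
      sgnFun D β (g * D.x) = sgnFun D β g ∧ sgnFun D β (g * c) = sgnFun D β g := by
  obtain ⟨e, v, rfl⟩ := exists_word D g
  rw [word_mul_i, word_mul_j, word_mul_x, word_mul_c, sgnFun_word, sgnFun_word, sgnFun_word, sgnFun_word, sgnFun_word, hβ.1, hβ.2.1, hβ.2.2.1]
  exact ⟨rfl, rfl, rfl, rfl⟩

omit hβ [DecidableEq G] in
/-- Right multiplication by a power of a generator. [folklore] -/
theorem sgnFun_mul_pow (g s : G) (δ : ZMod 2) (hs : ∀ h : G, sgnFun D β (h * s) = sgnFun D β h + δ) (n : ℕ) :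
    sgnFun D β (g * s ^ n) = sgnFun D β g + n • δ := by
  induction n with
  | zero => simp
  | succ n ih => rw [pow_succ, ← mul_assoc, hs, ih, succ_nsmul, add_assoc]

omit [DecidableEq G] in
/-- **An additive mask reads a homomorphism**: `sgnFun (g h) = sgnFun g + sgnFun h`. [folklore] -/
theorem sgnFun_mul (g h : G) : sgnFun D β (g * h) = sgnFun D β g + sgnFun D β h := by
  have key : ∀ g : G, ∀ u v d : ℕ, sgnFun D β (g * (D.i ^ u * D.j ^ v * D.x ^ d)) = sgnFun D β g + (u • β 1 + v • β 2) := by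
    intro g u v d
    rw [show g * (D.i ^ u * D.j ^ v * D.x ^ d) = g * D.i ^ u * D.j ^ v * D.x ^ d by group,
      sgnFun_mul_pow D _ D.x 0 (fun h => by rw [(sgnFun_mul_gen D hβ h).2.2.1, add_zero]) d,
      sgnFun_mul_pow D _ D.j (β 2) (fun h => (sgnFun_mul_gen D hβ h).2.1) v,
      sgnFun_mul_pow D _ D.i (β 1) (fun h => (sgnFun_mul_gen D hβ h).1) u, smul_zero, add_zero, add_assoc]
  obtain ⟨u, -, v, -, d, -, rfl⟩ := D.exhaust h
  have h1 := key 1 u v d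
  rw [one_mul, show sgnFun D β (1 : G) = 0 by rw [show (1 : G) = word D 0 0 by simp [word, xk, cpow], sgnFun_word, hβ.2.2.2], zero_add] at h1
  rw [key, h1]

/-- **The sign character** of an additive mask, `G →* Multiplicative (ℤ/2)`. [folklore] -/
def sgnHom : G →* Multiplicative (ZMod 2) where
  toFun g := Multiplicative.ofAdd (sgnFun D β g)
  map_one' := by
    rw [show (1 : G) = word D 0 0 by simp [word, xk, cpow], sgnFun_word, hβ.2.2.2]; rfl
  map_mul' g h := by rw [sgnFun_mul D hβ, ofAdd_add]

omit [DecidableEq G] in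
/-- `g ∈ ker (sgnHom)` iff the mask reads `0` on `g`. [folklore] -/
theorem mem_ker_sgnHom_iff (g : G) : g ∈ (sgnHom D hβ).ker ↔ sgnFun D β g = 0 := by
  rw [MonoidHom.mem_ker]
  show Multiplicative.ofAdd (sgnFun D β g) = Multiplicative.ofAdd 0 ↔ _
  exact Multiplicative.ofAdd.injective.eq_iff

omit [DecidableEq G] in
/-- The kernel of a sign character that does not vanish identically has index two. [folklore] -/
theorem index_ker_sgnHom {v : Fin 8} (hv : β v ≠ 0) : (sgnHom D hβ).ker.index = 2 := by
  rw [Subgroup.index_ker]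
  have hsurj : Function.Surjective (sgnHom D hβ) := by
    intro y
    have h01 : ∀ z : ZMod 2, z = 0 ∨ z = 1 := by decide
    have hv1 : β v = 1 := (h01 (β v)).resolve_left hv
    rcases h01 (Multiplicative.toAdd y) with hy | hy
    · exact ⟨1, by rw [map_one]; exact (toAdd_eq_zero.mp hy).symm⟩
    · refine ⟨word D 0 v, ?_⟩
      show Multiplicative.ofAdd (sgnFun D β (word D 0 v)) = y
      rw [sgnFun_word, hv1, ← hy, ofAdd_toAdd]
  rw [MonoidHom.range_eq_top.mpr hsurj, Subgroup.card_top, Nat.card_eq_fintype_card]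
  rfl

end Characters

omit [DecidableEq G] in
/-- **For `τ = 0` every word off the places `{0, 4}` squares to `c`** (`(iᵃ jᵇ xᵈ)² = c` unless `a = b = 0`; `x` central). [folklore] -/
theorem word_mul_self_eq_c (D : Datum G c 0) (e : ZMod 2) {v : Fin 8} (hv0 : v ≠ 0) (hv4 : v ≠ 4) : word D e v * word D e v = c := by
  have hxi : D.x * D.i = D.i * D.x := by rw [D.x_mul_i]; simp [cpow]
  have hxj : D.x * D.j = D.j * D.x := by rw [D.x_mul_j]; simp [cpow]
  have hk : D.i * D.j * (D.i * D.j) = c := D.ij_mul_ij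
  have key : xk D v * xk D v = c := by
    fin_cases v
    · exact absurd rfl hv0
    · exact D.hii
    · exact D.hjj
    · exact hk
    · exact absurd rfl hv4
    · show D.i * D.x * (D.i * D.x) = c
      rw [show D.i * D.x * (D.i * D.x) = D.i * (D.x * D.i) * D.x by group, hxi, show D.i * (D.i * D.x) * D.x = D.i * D.i * (D.x * D.x) by group,
        D.hxx, mul_one, D.hii]
    · show D.j * D.x * (D.j * D.x) = c
      rw [show D.j * D.x * (D.j * D.x) = D.j * (D.x * D.j) * D.x by group, hxj, show D.j * (D.j * D.x) * D.x = D.j * D.j * (D.x * D.x) by group,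
        D.hxx, mul_one, D.hjj]
    · show D.i * D.j * D.x * (D.i * D.j * D.x) = c
      rw [show D.i * D.j * D.x * (D.i * D.j * D.x) = D.i * D.j * (D.x * (D.i * D.j)) * D.x by group, D.x_mul_ij,
        show D.i * D.j * (D.i * D.j * D.x) * D.x = D.i * D.j * (D.i * D.j) * (D.x * D.x) by group, D.hxx, mul_one, hk]
  have hee : e + e = 0 := by have : ∀ z : ZMod 2, z + z = 0 := by decide
                             exact this e
  unfold word
  rw [show cpow c e * xk D v * (cpow c e * xk D v) = cpow c e * (xk D v * cpow c e) * xk D v by group, ← cpow_comm D e,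
    show cpow c e * (cpow c e * xk D v) * xk D v = cpow c e * cpow c e * (xk D v * xk D v) by group, cpow_mul_cpow' D, hee, key]
  simp [cpow]

omit [DecidableEq G] in
/-- **For `τ = 0` the kernel of an additive sign character contains `𝒦(G, c)`.** [folklore] -/
theorem stabGen_le_ker (D : Datum G c 0) {β : Fin 8 → ZMod 2}
    (hβ : (∀ v, β (πI v) = β v + β 1) ∧ (∀ v, β (πJ v) = β v + β 2) ∧ (∀ v, β (πX v) = β v) ∧ β 0 = 0) (h4 : β 4 = 0) : stabGen c ≤ (sgnHom D hβ).ker := by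
  rw [stabGen_le_iff_subset]
  refine ⟨?_, fun g hg => ?_⟩
  · rw [mem_ker_sgnHom_iff]
    have h := sgnFun_word D β 1 0
    rw [show word D 1 0 = c by simp [word, xk, cpow], hβ.2.2.2] at h
    exact h
  · rw [mem_ker_sgnHom_iff]
    obtain ⟨e, v, rfl⟩ := exists_word D g
    rw [sgnFun_word]
    by_contra hne
    apply hg
    have hv0 : v ≠ 0 := fun h => hne (by rw [h, hβ.2.2.2])
    have hv4 : v ≠ 4 := fun h => hne (by rw [h, h4])
    have hmem : word D e v ^ 2 ∈ Subgroup.zpowers (word D e v) := Subgroup.pow_mem _ (Subgroup.mem_zpowers _) 2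
    rw [pow_two, word_mul_self_eq_c D e hv0 hv4] at hmem
    exact hmem

omit [DecidableEq G] in
/-- **`d₂(G/𝒦) ≥ 2` for `Q₈ × ℤ/2`**: three distinct index-two subgroups contain `𝒦`. [folklore] -/
theorem two_le_indexTwoRank (D : Datum G c 0) : 2 ≤ indexTwoRank (stabGen c) := by
  classical
  haveI := stabGen_normal c (Subgroup.mem_center_iff.mp D.c_mem_center)
  let KA : {K : Subgroup G // K.index = 2 ∧ stabGen c ≤ K} :=
    ⟨(sgnHom D addMask_A).ker, index_ker_sgnHom D addMask_A (v := 1) (by decide), stabGen_le_ker D addMask_A (by decide)⟩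
  let KB : {K : Subgroup G // K.index = 2 ∧ stabGen c ≤ K} :=
    ⟨(sgnHom D addMask_B).ker, index_ker_sgnHom D addMask_B (v := 2) (by decide), stabGen_le_ker D addMask_B (by decide)⟩
  let KAB : {K : Subgroup G // K.index = 2 ∧ stabGen c ≤ K} :=
    ⟨(sgnHom D addMask_AB).ker, index_ker_sgnHom D addMask_AB (v := 1) (by decide), stabGen_le_ker D addMask_AB (by decide)⟩
  -- `j` separates the first kernel from the others, `i` the second from the third
  have hj : D.j = word D 0 2 := by simp [word, xk, cpow]
  have hi : D.i = word D 0 1 := by simp [word, xk, cpow]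
  have hjA : D.j ∈ (sgnHom D addMask_A).ker := by rw [mem_ker_sgnHom_iff, hj, sgnFun_word]; decide
  have hjB : D.j ∉ (sgnHom D addMask_B).ker := by rw [mem_ker_sgnHom_iff, hj, sgnFun_word]; decide
  have hjAB : D.j ∉ (sgnHom D addMask_AB).ker := by rw [mem_ker_sgnHom_iff, hj, sgnFun_word]; decide
  have hiB : D.i ∈ (sgnHom D addMask_B).ker := by rw [mem_ker_sgnHom_iff, hi, sgnFun_word]; decide
  have hiAB : D.i ∉ (sgnHom D addMask_AB).ker := by rw [mem_ker_sgnHom_iff, hi, sgnFun_word]; decide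
  haveI : Finite {K : Subgroup G // K.index = 2 ∧ stabGen c ≤ K} := Subtype.finite
  haveI := Fintype.ofFinite {K : Subgroup G // K.index = 2 ∧ stabGen c ≤ K}
  have h3 : 2 < Fintype.card {K : Subgroup G // K.index = 2 ∧ stabGen c ≤ K} := by
    rw [Fintype.two_lt_card_iff]
    refine ⟨KA, KB, KAB, fun h => hjB ?_, fun h => hjAB ?_, fun h => hiAB ?_⟩
    · have e : (sgnHom D addMask_A).ker = (sgnHom D addMask_B).ker := congrArg Subtype.val h
      exact e ▸ hjA
    · have e : (sgnHom D addMask_A).ker = (sgnHom D addMask_AB).ker := congrArg Subtype.val h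
      exact e ▸ hjA
    · have e : (sgnHom D addMask_B).ker = (sgnHom D addMask_AB).ker := congrArg Subtype.val h
      exact e ▸ hiB
  have h2 := two_pow_indexTwoRank (stabGen c)
  rw [Nat.card_eq_fintype_card] at h2
  by_contra hlt
  interval_cases h : indexTwoRank (stabGen c) <;> omega

/-! ## §3 The laws -/

/-- The table lengths of the plan for `Q₈ × ℤ/2`. [folklore] -/
theorem plan0_lengths : plan0.fam.length = 18 ∧ plan0.reps.length = 18 := ⟨rfl, rfl⟩

/-- The table lengths of the plan for the Pauli group. [folklore] -/
theorem plan1_lengths : plan1.fam.length = 20 ∧ plan1.reps.length = 22 := ⟨rfl, rfl⟩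

namespace Datum

/-- **THE LAW FOR `Q₈ × ℤ/2`, `c = (−1, 0)`**: `μ(G, c) = φ₂(G, c)`, and the row `φ₂ = 18 = β`, `d₂(G/𝒦) = 2`. [folklore] -/
theorem isLeast_card_gfaces_generate_fibreTwo_zero (D : Datum G c 0) :
    IsLeast {m : ℕ | ∃ S : Finset (CMF G c →₀ ℤ), ↑S ⊆ gfaceSet G c D.c_mul_c ∧ S.card = m ∧
      hodgeSpan c D.c_mul_c ≤ Submodule.span ℤ (pairSet c) ⊔ Submodule.span ℤ (translates c S)} (fibreTwo c D.c_mul_c) ∧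
    fibreTwo c D.c_mul_c = 18 ∧ Fintype.card (Block c) = 18 ∧ indexTwoRank (stabGen c) = 2 := by
  have h := isLeast_of_plan D plan0 plan0_valid (by rw [plan0_lengths.1, plan0_lengths.2]; have := two_le_indexTwoRank D; omega)
  rw [plan0_lengths.1, plan0_lengths.2] at h
  exact ⟨h.1, h.2.1, h.2.2.1, by omega⟩

/-- **THE LAW FOR THE PAULI GROUP `Q₈ ∘ ℤ/4`, `c = z²`**: `μ(G, c) = φ₂(G, c)`, and the row `φ₂ = 20`, `β = 22`, `d₂(G/𝒦) = 0`. [folklore] -/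
theorem isLeast_card_gfaces_generate_fibreTwo_one (D : Datum G c 1) :
    IsLeast {m : ℕ | ∃ S : Finset (CMF G c →₀ ℤ), ↑S ⊆ gfaceSet G c D.c_mul_c ∧ S.card = m ∧
      hodgeSpan c D.c_mul_c ≤ Submodule.span ℤ (pairSet c) ⊔ Submodule.span ℤ (translates c S)} (fibreTwo c D.c_mul_c) ∧
    fibreTwo c D.c_mul_c = 20 ∧ Fintype.card (Block c) = 22 ∧ indexTwoRank (stabGen c) = 0 := by
  have h := isLeast_of_plan D plan1 plan1_valid (by rw [plan1_lengths.1, plan1_lengths.2]; omega)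
  rw [plan1_lengths.1, plan1_lengths.2] at h
  exact ⟨h.1, h.2.1, h.2.2.1, by omega⟩

/-- **THE LAW FOR QUATERNION DOUBLINGS** (both twists): **`μ(G, c) = φ₂(G, c)`**. [folklore] -/
theorem isLeast_card_gfaces_generate_fibreTwo (D : Datum G c τ) :
    IsLeast {m : ℕ | ∃ S : Finset (CMF G c →₀ ℤ), ↑S ⊆ gfaceSet G c D.c_mul_c ∧ S.card = m ∧
      hodgeSpan c D.c_mul_c ≤ Submodule.span ℤ (pairSet c) ⊔ Submodule.span ℤ (translates c S)} (fibreTwo c D.c_mul_c) := by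
  have h01 : ∀ z : ZMod 2, z = 0 ∨ z = 1 := by decide
  rcases h01 τ with rfl | rfl
  · exact D.isLeast_card_gfaces_generate_fibreTwo_zero.1
  · exact D.isLeast_card_gfaces_generate_fibreTwo_one.1

/-- Block currency: **`μ(G, c) = β(G, c) − 2 + d₂(G/𝒦)`** (`= β` for `Q₈ × ℤ/2`, `= β − 2` for the Pauli group). [folklore] -/
theorem isLeast_card_gfaces_generate (D : Datum G c τ) :
    IsLeast {m : ℕ | ∃ S : Finset (CMF G c →₀ ℤ), ↑S ⊆ gfaceSet G c D.c_mul_c ∧ S.card = m ∧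
      hodgeSpan c D.c_mul_c ≤ Submodule.span ℤ (pairSet c) ⊔ Submodule.span ℤ (translates c S)}
      (Fintype.card (Block c) + indexTwoRank (stabGen c) - 2) := by
  have heven : Even (Fintype.card G / 2) := by rw [D.card_eq]; decide
  have hphi := fibreTwo_add_two_eq_card_block_add_indexTwoRank c D.c_mul_c D.c_ne_one (Subgroup.mem_center_iff.mp D.c_mem_center) heven
  rw [show Fintype.card (Block c) + indexTwoRank (stabGen c) - 2 = fibreTwo c D.c_mul_c by omega]
  exact D.isLeast_card_gfaces_generate_fibreTwo

end Datum

end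

end Summit.HodgeConjecture.CorCM.Census.QuaternionDoubling
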